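/-
Copyright: statement-level skeleton of a published paper (lit-balaban cell, Phase-2 proof seat p13, gen 7). No proof
claims beyond what the kernel checks below.
-/
import Literature.MathematicalPhysics.QuantumFieldTheory.BalabanImbrieJaffe1984to88.BIJ88Ineq247Walks
import Literature.MathematicalPhysics.QuantumFieldTheory.BalabanImbrieJaffe1984to88.BIJ88Locality246Lattice

/-!
# `BalabanImbrieJaffe1984to88.BIJ88RandomWalk578` — T. Bałaban, J. Imbrie, A. Jaffe, *Effective action and cluster
properties of the abelian Higgs model*, Commun. Math. Phys. **114** (1988) 257–315 [BalabanImbrieJaffe1988]: Sect. 5.7,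
**(5.7.8)** p. 291 — the random walk expansion of the propagator `G_j(Ω,u)` *"given in [6]"*
([6] = [Balaban1983RegularityDecay], (2.12)–(2.13) p. 577), its resummation
`G_j(Ω,u) = G_{j,loc}(Ω,u) + Σ_X G_j(Ω,X,u)` (5.7.8) and the five clauses printed after it, PROVED for [6]'s walk terms
read as KERNELS (matrix entries over a finite site set)

statement-level skeleton of published theorems with citation tags; proofs where landed; nothing here is a claim about the Yang–Mills mass gap

PDF held: `paper:balaban1988-cmp114-bij-abelian-higgs-effective-action` (journal page = PDF page + 256); p. 291 [PDF 35]
read as an IMAGE (CCITT render `pages/original-p035-x2.png` in the seat folder; the OCR layer garbles the displays).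

CITATION HEADER (lean-in-tree rule).  Part of the lit-balaban TYPED SKELETON (HOME `run/shared/lean/pub/lit-balaban/`):
WHAT IS REPRODUCED = row **C2.Eq5.7.7-5.7.9** of `HOME/lit-balaban-r16/ROWS-C2-part2.md`, member **(5.7.8)** (status
before this file: *«(5.7.7)–(5.7.8) absent»*), unit `lit-balaban-p13` (gen 7), owner r16, referee ref-5.  Companion
files REUSED BY NAME, nothing restated: `Balaban1983to89.B4RandomWalk213` ([6] (2.13): `bprod`, `IsWalk`, `cubeAdj`,
`card_cubeAdj_le`), `BIJ88RandomWalk242` (p13 g2: `Walk`, `Eq242`, `Near`, `cLoc`, `cubesMet`, `region`, `cX`, `memX`,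
`eq245_of_eq242`, `cX_support`, `cLoc_eq_zero_of_far`, `cLoc_congr`, `walkTerm`, `hasSum_walkTerm`,
`eq242_of_walkTerm`), `BIJ88Ineq246Walks` / `BIJ88Ineq247Walks` (p36 g2: `abs_cX_le_printed`, `walkTerm_hyps`),
`BIJ88Eq242Lattice` (p13 g2: `entryHom`, `abs_entry_le_norm`), `BIJ88Locality246Lattice` (p13 g6: `bprod_congr_of_eq`),
`BIJ88Sect2Statements` (r18: `Eq245`, `convexComb`, `IsConvexWeights`).

## The print (p. 291 [PDF 35], verbatim)

*"We must replace G_j(□(x₁,x₂), u_{k+1}) with G_j(Ω, u_{k+1}) for some fixed Ω. This is accomplished with a random walk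
expansion for G_j(Ω,u). Such an expansion is given in [6]. It takes the form G_j(Ω,u) = Σ_ω G(ω), where ω is a walk on
the lattice of M-cubes in T_{L^{−j}}. Each G(ω) has regularity as in (2.30), as well as an exponential decay in the
length of the walk. By summing over an appropriate subset of walks that remain inside X, a union of L^{k−j}r(e_k)-cubes,
we obtain G_j(Ω,X,u). [An analogous construction for C^{(k)}_Λ(u) is described in (2.42)–(2.45).] Walks that stay within
□(x₁,x₂)∩Ω define G_{j,loc}(Ω,u; x₁,x₂), which is then nonzero only if |x₁ − x₂| ≦ O(L^{k−j}r(e_k)). A convex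
combination as in (2.27) is used to preserve regularity across boundaries of M-cubes. The result is the expansion
G_j(Ω,u) = G_{j,loc}(Ω,u) + Σ_X G_j(Ω,X,u). (5.7.8)  Of course, G_j(Ω,X,u; x₁,x₂) = 0 unless both x₁ and x₂ are in
X. All operators obey the usual regularity bounds, provided dist({x₁,x₂},Ω^c) > c. The bound on G_j(Ω,X,u) has in
addition a factor e^{−cr(e_k)L^{k−j}|X|}. The dependence on u is in X only; for G_{j,loc} it is only in an
L^{k−j}r(e_k)-neighborhood of x₁, x₂. Also, when x₁ and x₂ are farther than L^{k−j}r(e_k) from Ω^c, G_{j,loc} is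
independent of Ω."*  — [6] p. 577: *"(2.13) G_k(Ω,A) = Σ_ω h_{ω₀}G_k(□_{ω₀},Ã_{ω₀})h_{ω₀}K_{ω₁}G_k(□_{ω₁},Ã_{ω₁})h_{ω₁}
… K_{ω_n}G_k(□_{ω_n},Ã_{ω_n})h_{ω_n}"* over nearest-neighbour walks `ω = {ω₀, …, ω_n}` on the `M`-cube lattice,
obtained from *"(2.12) G_k(Ω,A) = G₀(I − R)^{−1} = Σ_n G₀Rⁿ"*, `G₀ = Σ_j h_jG_k(□_j,Ã_j)h_j` (2.2), `R = Σ_j K_jG_k(□_j,Ã_j)h_j`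
(2.11).

## The typing (READING, declared)

* SETTING OF [6] AT THE KERNEL LEVEL.  Sites `σ` (a finite type: the points of `Ω`), operators = `Matrix σ σ ℝ` with the
  `ℓ^∞ → ℓ^∞` operator norm (Mathlib scope `Matrix.Norms.Operator`); labels `ι` = the `M`-cubes `□_j`, finite, with an
  adjacency `adj` (print: `|j − j′|_∞ ≤ 1`); [6]'s LETTERS `a_j = h_jG_k(□_j,Ã_j)h_j`, `b_j = K_jG_k(□_j,Ã_j)h_j` are two
  families `a b : ι → Matrix σ σ ℝ`; the walk term `G(ω) = a_{ω₀}b_{ω₁}⋯b_{ω_n}` is `BIJ88RandomWalk242.walkTerm a b ω`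
  and its kernel `G(ω)(x₁,x₂)` the matrix entry.  [6]'s structural facts enter as HYPOTHESES named as in
  `BIJ88RandomWalk242.hasSum_walkTerm`: locality `a_ib_l = 0 = b_ib_l` unless `i ~ l` (the *"obvious fact"* of p. 577),
  `‖a_i‖ ≤ α`, `‖b_i‖ ≤ β` with `Dβ < 1` (`D` successors; Lemma 2.1 of [6]), `‖R‖ < 1` and `G(1 − R) = G₀` ((2.12)).
  END-POINT SUPPORTS (the outer `h_{ω₀}`, `h_{ω_n}` of (2.13)): rows AND columns of `a_j` and columns of `b_j` vanish
  off the block `□_j` (`blk x j` = *"x lies in □_j"*, i.e. `h_j(x) ≠ 0`).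
* `G(ω) = walkTerm a b ω`; *"G_j(Ω,u) = Σ_ω G(ω)"* = `Eq242 (G · ·) (G(ω) · ·)` (unconditional entrywise `HasSum` over ALL
  label tuples; non-nearest-neighbour tuples carry `0` by locality) — PROVED (`eq242_G`).
* By the bracket sentence *"[An analogous construction for C^{(k)}_Λ(u) is described in (2.42)–(2.45).]"* the classes of
  walks are those of the (2.43)/(2.44) construction of `BIJ88RandomWalk242` (owner reading R1 of r18, 2026-08-21T01:19Z:
  `X(ω) := region ω`, the `L^{k−j}r(e_k)`-cubes met by `ω` plus their boundary layer): `G_{j,loc}(Ω,u;x₁,x₂) :=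
  cLoc ldist ρ G(·)` = the sum over the walks *"that stay within □(x₁,x₂)"* — read as `Near ldist ρ ω x₁ x₂`, every
  visited label within `ρ = O(L^{k−j}r(e_k))` of `x₁` and of `x₂` for a label-to-site distance `ldist` — and
  `G_j(Ω,X,u;x₁,x₂) := cX ldist ρ cubeOf cadj G(·) X` = the sum over the remaining walks with `X(ω) = X`, indexed by ALL
  finite sets `X` of cubes (`cubeOf : ι → κ` the big cube of a label, `cadj` their adjacency).  (5.7.8) =
  `BIJ88Sect2Statements.Eq245 G G_loc G_X` — PROVED (`eq578`).  The print's *"A convex combination as in (2.27) is used"*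
  is the variant `eq578_convex`: for convex weights `λ_α(x₁,x₂)` (`IsConvexWeights`) and one primed class per cube `□_α`
  (`ldist α`, `ρ α`; e.g. `ldist α j _ := |j − centre(□_α)|_∞`, `ρ α :=` half-side, which is literally *"walks that
  stay within □_α"*), `G = Σ_α λ_αG^{α}_loc + Σ_X Σ_α λ_αG^{α}_X` (`convexComb`).
* The clauses: support (`gX_support`, from end-point locality `walkTerm_support`, itself DERIVED from the block supports
  of the letters); *"nonzero only if |x₁ − x₂| ≦ O(L^{k−j}r(e_k))"* (`gLoc_eq_zero_of_far`: `|x₁ − x₂| > 2ρ ⇒ 0`);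
  the factor `e^{−c·r(e_k)L^{k−j}·|X|}` (`abs_gX_le`: p36's (2.46) mechanism `abs_cX_le_printed` fed with the majorant
  `αβⁿ` and the end-point structure of [6]'s terms — the label/cube GEOMETRY stays hypotheses exactly as there, discharged
  on `ℤ^d` in `BIJ88WalkGeometryZd` / `BIJ88Ineq247Walks.ineq246_Zd`); *"The dependence on u is in X only; for G_{j,loc}
  … neighborhood of x₁, x₂"* and *"G_{j,loc} is independent of Ω"* as TERMWISE CONGRUENCES (`walkTerm_congr`,
  `gX_congr`, `gLoc_congr`): two letter families — [6]'s letters for two backgrounds `u, u′`, or for two regions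
  `Ω, Ω′` realized on a common site set — which coincide at the labels whose cube lies in `X` (resp. within `ρ` of
  `x₁`) give the same `G_X` (resp. the same `G_loc(x₁,x₂)`); [6]'s letters at label `j` depend on `u` and on `Ω` only
  through `□_j` (`G_k(□_j ∩ Ω, Ã_j)`, `h_j`, `K_j`), which is the dictionary making these the printed sentences.
* NOT HERE (honestly): the operators `G_k(□_j,Ã_j)`, `h_j`, `K_j` themselves and [6]'s Lemma 2.1 (they are the cell's
  `Balaban1983to89.B4Eq213ConcreteWalk` letters, whose locality is discharged there); *"Each G(ω) has regularity as in
  (2.30)"* and *"All operators obey the usual regularity bounds"* (Hölder regularity of [6], rows B4.Thm@573/C2.Eq2.30);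
  the identification `ρ ↔ L^{k−j}r(e_k)`, `|X| ↔` number of `L^{k−j}r(e_k)`-cubes is the dictionary of the hypotheses.
  No `def`, no `Prop` fact, no `sorry`; axioms standard.
-/

-- v1.1 (same seat, gen 7): APPEND-ONLY §8 (the p. 293 rewriting of `G_{j,loc}` derived from (5.7.8), sign corrected); no v1
-- declaration changed.

namespace Literature.MathematicalPhysics.QuantumFieldTheory.BalabanImbrieJaffe1984to88.BIJ88RandomWalk578

open Finset
open Literature.MathematicalPhysics.QuantumFieldTheory.Balaban1983to89.B4RandomWalk213
open BIJ88RandomWalk242 BIJ88Ineq246Walks BIJ88Ineq247Walks BIJ88Eq242Lattice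
open scoped Matrix Matrix.Norms.Operator

variable {ι σ κ : Type*} [Fintype ι] [DecidableEq ι] [Fintype σ] [DecidableEq σ] [Fintype κ] [DecidableEq κ]

/-! ## §1 *"G_j(Ω,u) = Σ_ω G(ω) … Such an expansion is given in [6]"* — [6] (2.12)–(2.13) for kernels -/

omit [Fintype κ] [DecidableEq κ] in
/-- **THE EXPANSION OF [6] FOR `G_j(Ω,u)`, OPERATOR FORM** (p. 291: *"G_j(Ω,u) = Σ_ω G(ω), where ω is a walk on the
lattice of M-cubes"*; [6] (2.12)–(2.13) p. 577): for [6]'s letters `a_j = h_jG_k(□_j,Ã_j)h_j`, `b_j = K_jG_k(□_j,Ã_j)h_j`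
as kernels on a finite site set — LOCAL (`a_ib_l = 0 = b_ib_l` unless `i ~ l`), `‖a_i‖ ≤ α`, `‖b_i‖ ≤ β` (the
`ℓ^∞ → ℓ^∞` operator norm), at most `D` neighbours per label, `Dβ < 1`, `‖R‖ < 1`, `G(1 − R) = G₀` (`G₀ = Σ_ja_j`,
`R = Σ_jb_j`) — the walk terms `G(ω) = a_{ω₀}b_{ω₁}⋯b_{ω_n}` sum UNCONDITIONALLY to `G` over all label tuples `ω`.
[cite: BalabanImbrieJaffe1988, (5.7.8) p.291] -/
theorem hasSum_G (adj : ι → ι → Prop) [DecidableRel adj] {a b : ι → Matrix σ σ ℝ} {G : Matrix σ σ ℝ} {α β : ℝ}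
    {D : ℕ} (hab : ∀ i l, ¬ adj i l → a i * b l = 0) (hbb : ∀ i l, ¬ adj i l → b i * b l = 0)
    (hα : ∀ i, ‖a i‖ ≤ α) (hβ : ∀ i, ‖b i‖ ≤ β) (hD : ∀ j, (Finset.univ.filter fun i => adj j i).card ≤ D)
    (hDβ : (D : ℝ) * β < 1) (hR : ‖∑ i, b i‖ < 1) (hG : G * (1 - ∑ i, b i) = ∑ i, a i) :
    HasSum (walkTerm a b) G := by
  haveI : CompleteSpace (Matrix σ σ ℝ) := FiniteDimensional.complete ℝ (Matrix σ σ ℝ)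
  exact hasSum_walkTerm adj hab hbb hα hβ hD hDβ hR hG

omit [Fintype κ] [DecidableEq κ] in
/-- **THE EXPANSION OF [6] FOR `G_j(Ω,u)`, KERNEL FORM** (p. 291, *"G_j(Ω,u) = Σ_ω G(ω)"*): under the hypotheses of
`hasSum_G`, for every pair of sites `HasSum (ω ↦ G(ω)(x₁,x₂)) (G(x₁,x₂))` — the typed (2.42)-shape
`BIJ88RandomWalk242.Eq242` for the kernels `G(x₁,x₂)` and `G(ω)(x₁,x₂) = (a_{ω₀}b_{ω₁}⋯b_{ω_n})(x₁,x₂)` (entries are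
continuous in the operator norm, `BIJ88Eq242Lattice.abs_entry_le_norm`). [cite: BalabanImbrieJaffe1988, (5.7.8) p.291] -/
theorem eq242_G (adj : ι → ι → Prop) [DecidableRel adj] {a b : ι → Matrix σ σ ℝ} {G : Matrix σ σ ℝ} {α β : ℝ}
    {D : ℕ} (hab : ∀ i l, ¬ adj i l → a i * b l = 0) (hbb : ∀ i l, ¬ adj i l → b i * b l = 0)
    (hα : ∀ i, ‖a i‖ ≤ α) (hβ : ∀ i, ‖b i‖ ≤ β) (hD : ∀ j, (Finset.univ.filter fun i => adj j i).card ≤ D)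
    (hDβ : (D : ℝ) * β < 1) (hR : ‖∑ i, b i‖ < 1) (hG : G * (1 - ∑ i, b i) = ∑ i, a i) :
    Eq242 (fun x₁ x₂ => G x₁ x₂) (fun ω x₁ x₂ => walkTerm a b ω x₁ x₂) := by
  haveI : CompleteSpace (Matrix σ σ ℝ) := FiniteDimensional.complete ℝ (Matrix σ σ ℝ)
  have hevc : ∀ x₁ x₂ : σ, Continuous (entryHom (m := σ) x₁ x₂) := fun x₁ x₂ =>
    AddMonoidHomClass.continuous_of_bound (entryHom x₁ x₂) 1 fun B => by
      rw [one_mul, Real.norm_eq_abs]; exact abs_entry_le_norm B x₁ x₂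
  exact eq242_of_walkTerm adj hab hbb hα hβ hD hDβ hR hG entryHom hevc

/-! ## §2 End-point locality of [6]'s terms `G(ω)` from the block supports of the letters -/

section Support

variable (blk : σ → ι → Prop)

omit [Fintype ι] [DecidableEq ι] [DecidableEq σ] [Fintype κ] [DecidableEq κ] in
/-- a left factor whose row `x₁` vanishes kills the entry `(x₁,x₂)` of any product: the outer `h_{ω₀}` of (2.13) on the
left. [cite: BalabanImbrieJaffe1988, (5.7.8) p.291] -/
theorem mul_apply_eq_zero_of_row {A B : Matrix σ σ ℝ} {x₁ x₂ : σ} (h : ∀ z, A x₁ z = 0) : (A * B) x₁ x₂ = 0 := by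
  rw [Matrix.mul_apply]
  exact Finset.sum_eq_zero fun z _ => by rw [h z, zero_mul]

omit [Fintype ι] [DecidableEq ι] [DecidableEq σ] [Fintype κ] [DecidableEq κ] in
/-- a right factor whose column `x₂` vanishes kills the entry `(x₁,x₂)` of any product: the outer `h_{ω_n}` of (2.13) on
the right. [cite: BalabanImbrieJaffe1988, (5.7.8) p.291] -/
theorem mul_apply_eq_zero_of_col {A B : Matrix σ σ ℝ} {x₁ x₂ : σ} (h : ∀ z, B z x₂ = 0) : (A * B) x₁ x₂ = 0 := by
  rw [Matrix.mul_apply]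
  exact Finset.sum_eq_zero fun z _ => by rw [h z, mul_zero]

omit [Fintype ι] [DecidableEq ι] [Fintype κ] [DecidableEq κ] in
/-- **THE KERNELS `G(ω)(x₁,x₂)` OF [6] SATISFY THE HYPOTHESES OF THE (2.43)–(2.47) MACHINERY.**  If the rows and the
columns of `a_j = h_jG_k(□_j,Ã_j)h_j` and the columns of `b_j = K_jG_k(□_j,Ã_j)h_j` vanish off the block `□_j`
(`blk x j`: *"x lies in □_j"*, i.e. `h_j(x) ≠ 0`), the letters are LOCAL and `‖a_i‖ ≤ α`, `‖b_i‖ ≤ β`, then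
(i) `|G(ω)(x₁,x₂)| ≤ α·βⁿ` (*"an exponential decay in the length of the walk"*, given `β < 1`), and (ii)
`G(ω)(x₁,x₂) ≠ 0 ⇒ ω` is a nearest-neighbour walk with `x₁ ∈ □_{ω₀}` and `x₂ ∈ □_{ω_n}` (END-POINT LOCALITY) — p36's
`BIJ88Ineq247Walks.walkTerm_hyps` for the entry maps `entryHom` (`E = 1`, `abs_entry_le_norm`).
[cite: BalabanImbrieJaffe1988, (5.7.8) p.291] -/
theorem walkTerm_entry_hyps (adj : ι → ι → Prop) {a b : ι → Matrix σ σ ℝ} {α β : ℝ}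
    (hab : ∀ i l, ¬ adj i l → a i * b l = 0) (hbb : ∀ i l, ¬ adj i l → b i * b l = 0)
    (hα : ∀ i, ‖a i‖ ≤ α) (hβ : ∀ i, ‖b i‖ ≤ β)
    (haR : ∀ j x, ¬ blk x j → ∀ z, a j x z = 0) (haC : ∀ j x, ¬ blk x j → ∀ z, a j z x = 0)
    (hbC : ∀ j x, ¬ blk x j → ∀ z, b j z x = 0) :
    (∀ ω x₁ x₂, |walkTerm a b ω x₁ x₂| ≤ α * β ^ ω.len) ∧
      ∀ ω x₁ x₂, walkTerm a b ω x₁ x₂ ≠ 0 → ω.IsNN adj ∧ blk x₁ ω.start ∧ blk x₂ ω.last := by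
  obtain ⟨hmaj, hnz⟩ := walkTerm_hyps adj hab hbb hα hβ zero_le_one (entryHom (m := σ))
    (fun x₁ x₂ r => by rw [one_mul]; exact abs_entry_le_norm r x₁ x₂) blk
    (fun _ _ i r h => mul_apply_eq_zero_of_row (haR i _ h) (B := r))
    (fun _ _ j r h => mul_apply_eq_zero_of_col (hbC j _ h) (A := r))
    (fun _ x₂ j h => haC j x₂ h _)
  exact ⟨fun ω x₁ x₂ => by rw [← one_mul α]; exact hmaj ω x₁ x₂, hnz⟩

omit [Fintype ι] [DecidableEq ι] [Fintype κ] [DecidableEq κ] in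
/-- **END-POINT LOCALITY of `G(ω)`** (the outer `h_{ω₀} … h_{ω_n}` of [6] (2.13)): `G(ω)(x₁,x₂) ≠ 0 ⇒ x₁ ∈ □_{ω₀}`
and `x₂ ∈ □_{ω_n}`, from the block supports of the letters alone. [cite: BalabanImbrieJaffe1988, (5.7.8) p.291] -/
theorem walkTerm_support {a b : ι → Matrix σ σ ℝ}
    (haR : ∀ j x, ¬ blk x j → ∀ z, a j x z = 0) (haC : ∀ j x, ¬ blk x j → ∀ z, a j z x = 0)
    (hbC : ∀ j x, ¬ blk x j → ∀ z, b j z x = 0) :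
    ∀ ω x₁ x₂, walkTerm a b ω x₁ x₂ ≠ 0 → blk x₁ ω.start ∧ blk x₂ ω.last := by
  intro ω x₁ x₂ hne
  refine ⟨?_, ?_⟩
  · by_contra h
    exact hne (by unfold walkTerm; exact mul_apply_eq_zero_of_row (haR _ _ h))
  · by_contra h
    rcases ω with ⟨s, n, ys⟩
    cases n with
    | zero =>
        refine hne ?_
        show (a s * bprod b 0 ys) x₁ x₂ = 0
        rw [bprod_zero, mul_one]
        exact haC s x₂ h x₁
    | succ n =>
        refine hne ?_
        show entryHom x₁ x₂ (a s * bprod b (n + 1) ys) = 0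
        exact ev_mul_bprod_eq_zero_of_last (entryHom x₁ x₂) b (Bad := fun j => ¬ blk x₂ j)
          (fun j r hj => mul_apply_eq_zero_of_col (A := r) (hbC j _ hj)) n (a s) ys h

end Support

/-! ## §3 **(5.7.8)** `G_j(Ω,u) = G_{j,loc}(Ω,u) + Σ_X G_j(Ω,X,u)`, PROVED -/

/-- **(5.7.8)** p. 291 [PDF 35], verbatim: *"By summing over an appropriate subset of walks that remain inside X, a union
of L^{k−j}r(e_k)-cubes, we obtain G_j(Ω,X,u). [An analogous construction for C^{(k)}_Λ(u) is described in (2.42)–(2.45).]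
Walks that stay within □(x₁,x₂)∩Ω define G_{j,loc}(Ω,u; x₁,x₂) … The result is the expansion G_j(Ω,u) = G_{j,loc}(Ω,u)
+ Σ_X G_j(Ω,X,u). (5.7.8)"* — PROVED for [6]'s expansion read as kernels: under the hypotheses of `hasSum_G`, with
`G_{j,loc} := cLoc ldist ρ G(·)` (walks within `ρ` of `x₁, x₂`, `ρ = O(L^{k−j}r(e_k))`) and `G_j(Ω,X,u) := cX ldist ρ
cubeOf cadj G(·) X` (remaining walks with cube region `X`), the typed identity `BIJ88Sect2Statements.Eq245 G G_loc G_X`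
holds, `G(x₁,x₂) = G_loc(x₁,x₂) + Σ_X G_X(x₁,x₂)` for all sites, for EVERY label-to-site distance `ldist`, radius `ρ`,
cube map `cubeOf` and cube adjacency `cadj` — the analogous construction (2.42)–(2.45), `BIJ88RandomWalk242.eq245_of_eq242`.
[cite: BalabanImbrieJaffe1988, (5.7.8) p.291] -/
theorem eq578 (adj : ι → ι → Prop) [DecidableRel adj] {a b : ι → Matrix σ σ ℝ} {G : Matrix σ σ ℝ} {α β : ℝ}
    {D : ℕ} (hab : ∀ i l, ¬ adj i l → a i * b l = 0) (hbb : ∀ i l, ¬ adj i l → b i * b l = 0)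
    (hα : ∀ i, ‖a i‖ ≤ α) (hβ : ∀ i, ‖b i‖ ≤ β) (hD : ∀ j, (Finset.univ.filter fun i => adj j i).card ≤ D)
    (hDβ : (D : ℝ) * β < 1) (hR : ‖∑ i, b i‖ < 1) (hG : G * (1 - ∑ i, b i) = ∑ i, a i)
    (ldist : ι → σ → ℝ) (ρ : ℝ) (cubeOf : ι → κ) (cadj : κ → κ → Prop) :
    BIJ88Sect2Statements.Eq245 (fun x₁ x₂ => G x₁ x₂)
      (cLoc ldist ρ fun ω x₁ x₂ => walkTerm a b ω x₁ x₂)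
      (cX ldist ρ cubeOf cadj fun ω x₁ x₂ => walkTerm a b ω x₁ x₂) :=
  eq245_of_eq242 ldist ρ cubeOf cadj (eq242_G adj hab hbb hα hβ hD hDβ hR hG)

omit [Fintype ι] [Fintype σ] [DecidableEq σ] in
/-- **(5.7.8) WITH THE CONVEX COMBINATION**, p. 291: *"A convex combination as in (2.27) is used to preserve regularity
across boundaries of M-cubes."* — for ANY kernels satisfying the expansion (2.42)-shape `Eq242 C C(·)`, any finite family
of primed classes (one per cube `□_α`: `ldist α`, `ρ α` — e.g. `ldist α j _ = |j − centre(□_α)|_∞`, `ρ α =` half-side,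
i.e. *"walks that stay within □_α"*) and any weights with `Σ_α λ_α(x₁,x₂) = 1` (`BIJ88Sect2Statements.IsConvexWeights`,
(2.27)), the identity holds with the SMOOTHED local part `Σ_α λ_α(x₁,x₂)C^{α}_loc(x₁,x₂)` and the parts
`Σ_α λ_α(x₁,x₂)C^{α}_X(x₁,x₂)` (`BIJ88Sect2Statements.convexComb`). [cite: BalabanImbrieJaffe1988, (5.7.8) p.291] -/
theorem eq578_convex {η : Type*} [Fintype η] {C : σ → σ → ℝ} {Cw : Walk ι → σ → σ → ℝ} (h : Eq242 C Cw)
    (w : η → σ → σ → ℝ) (hw : ∀ x₁ x₂, ∑ α, w α x₁ x₂ = 1) (ldist : η → ι → σ → ℝ) (ρ : η → ℝ)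
    (cubeOf : ι → κ) (cadj : κ → κ → Prop) :
    BIJ88Sect2Statements.Eq245 C
      (BIJ88Sect2Statements.convexComb w fun α => cLoc (ldist α) (ρ α) Cw)
      (fun X => BIJ88Sect2Statements.convexComb w fun α => cX (ldist α) (ρ α) cubeOf cadj Cw X) := by
  intro x₁ x₂
  have hα : ∀ α, C x₁ x₂ = cLoc (ldist α) (ρ α) Cw x₁ x₂ + ∑ X, cX (ldist α) (ρ α) cubeOf cadj Cw X x₁ x₂ :=
    fun α => eq245_of_eq242 (ldist α) (ρ α) cubeOf cadj h x₁ x₂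
  unfold BIJ88Sect2Statements.convexComb
  calc C x₁ x₂ = ∑ α, w α x₁ x₂ * C x₁ x₂ := by rw [← Finset.sum_mul, hw, one_mul]
    _ = ∑ α, (w α x₁ x₂ * cLoc (ldist α) (ρ α) Cw x₁ x₂ +
          ∑ X, w α x₁ x₂ * cX (ldist α) (ρ α) cubeOf cadj Cw X x₁ x₂) :=
        Finset.sum_congr rfl fun α _ => by rw [hα α, mul_add, Finset.mul_sum]
    _ = (∑ α, w α x₁ x₂ * cLoc (ldist α) (ρ α) Cw x₁ x₂) +
          ∑ X, ∑ α, w α x₁ x₂ * cX (ldist α) (ρ α) cubeOf cadj Cw X x₁ x₂ := by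
        rw [Finset.sum_add_distrib, Finset.sum_comm]

/-- (5.7.8) with the convex combination, for [6]'s kernels `G(ω)(x₁,x₂)` under the hypotheses of `hasSum_G`.
[cite: BalabanImbrieJaffe1988, (5.7.8) p.291] -/
theorem eq578_convex_G {η : Type*} [Fintype η] (adj : ι → ι → Prop) [DecidableRel adj] {a b : ι → Matrix σ σ ℝ}
    {G : Matrix σ σ ℝ} {α β : ℝ} {D : ℕ} (hab : ∀ i l, ¬ adj i l → a i * b l = 0)
    (hbb : ∀ i l, ¬ adj i l → b i * b l = 0) (hα : ∀ i, ‖a i‖ ≤ α) (hβ : ∀ i, ‖b i‖ ≤ β)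
    (hD : ∀ j, (Finset.univ.filter fun i => adj j i).card ≤ D) (hDβ : (D : ℝ) * β < 1) (hR : ‖∑ i, b i‖ < 1)
    (hG : G * (1 - ∑ i, b i) = ∑ i, a i) (w : η → σ → σ → ℝ) (hw : ∀ x₁ x₂, ∑ α, w α x₁ x₂ = 1)
    (ldist : η → ι → σ → ℝ) (ρ : η → ℝ) (cubeOf : ι → κ) (cadj : κ → κ → Prop) :
    BIJ88Sect2Statements.Eq245 (fun x₁ x₂ => G x₁ x₂)
      (BIJ88Sect2Statements.convexComb w fun α => cLoc (ldist α) (ρ α) fun ω x₁ x₂ => walkTerm a b ω x₁ x₂)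
      (fun X => BIJ88Sect2Statements.convexComb w fun α =>
        cX (ldist α) (ρ α) cubeOf cadj (fun ω x₁ x₂ => walkTerm a b ω x₁ x₂) X) :=
  eq578_convex (eq242_G adj hab hbb hα hβ hD hDβ hR hG) w hw ldist ρ cubeOf cadj

/-! ## §4 *"Of course, G_j(Ω,X,u; x₁,x₂) = 0 unless both x₁ and x₂ are in X"* -/

omit [Fintype ι] in
/-- **SUPPORT CLAUSE** p. 291, verbatim: *"Of course, G_j(Ω,X,u; x₁,x₂) = 0 unless both x₁ and x₂ are in X."* — PROVED
from the block supports of [6]'s letters (rows/columns of `a_j`, columns of `b_j` off `□_j` vanish): `G_X(x₁,x₂) = 0`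
unless `x₁` and `x₂` each lie in a block `□_j` whose cube closure is inside `X` (`BIJ88RandomWalk242.memX`), for every
`ldist`, `ρ`, `cubeOf`, `cadj`. [cite: BalabanImbrieJaffe1988, (5.7.8) p.291] -/
theorem gX_support (blk : σ → ι → Prop) {a b : ι → Matrix σ σ ℝ}
    (haR : ∀ j x, ¬ blk x j → ∀ z, a j x z = 0) (haC : ∀ j x, ¬ blk x j → ∀ z, a j z x = 0)
    (hbC : ∀ j x, ¬ blk x j → ∀ z, b j z x = 0)
    (ldist : ι → σ → ℝ) (ρ : ℝ) (cubeOf : ι → κ) (cadj : κ → κ → Prop) :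
    ∀ X x₁ x₂, ¬ (memX blk cubeOf cadj x₁ X ∧ memX blk cubeOf cadj x₂ X) →
      cX ldist ρ cubeOf cadj (fun ω x₁ x₂ => walkTerm a b ω x₁ x₂) X x₁ x₂ = 0 :=
  cX_support ldist ρ cubeOf cadj blk (walkTerm_support blk haR haC hbC)

/-! ## §5 *"G_{j,loc}(Ω,u; x₁,x₂) … is then nonzero only if |x₁ − x₂| ≦ O(L^{k−j}r(e_k))"* -/

omit [Fintype ι] [Fintype κ] [DecidableEq κ] in
/-- **RANGE OF THE LOCAL PART** p. 291, verbatim: *"Walks that stay within □(x₁,x₂)∩Ω define G_{j,loc}(Ω,u; x₁,x₂),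
which is then nonzero only if |x₁ − x₂| ≦ O(L^{k−j}r(e_k))."* — for a site distance dominated through any label
(`|x₁ − x₂| ≤ ldist(j,x₁) + ldist(j,x₂)`), `G_loc(x₁,x₂) = 0` as soon as `|x₁ − x₂| > 2ρ` (`ρ = O(L^{k−j}r(e_k))`):
`BIJ88RandomWalk242.cLoc_eq_zero_of_far`. [cite: BalabanImbrieJaffe1988, (5.7.8) p.291] -/
theorem gLoc_eq_zero_of_far {a b : ι → Matrix σ σ ℝ} (ldist : ι → σ → ℝ) (ρ : ℝ) (sdist : σ → σ → ℝ)
    (htri : ∀ j x₁ x₂, sdist x₁ x₂ ≤ ldist j x₁ + ldist j x₂) {x₁ x₂ : σ} (hfar : 2 * ρ < sdist x₁ x₂) :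
    cLoc ldist ρ (fun ω x₁ x₂ => walkTerm a b ω x₁ x₂) x₁ x₂ = 0 :=
  cLoc_eq_zero_of_far ldist ρ _ sdist htri hfar

/-! ## §6 *"The bound on G_j(Ω,X,u) has in addition a factor e^{−cr(e_k)L^{k−j}|X|}"* -/

/-- **THE FACTOR `e^{−c·r(e_k)L^{k−j}·|X|}`** p. 291, verbatim: *"The bound on G_j(Ω,X,u) has in addition a factor
e^{−cr(e_k)L^{k−j}|X|}."* — PROVED by the (2.46) mechanism of p36's `BIJ88Ineq246Walks.abs_cX_le_printed` for [6]'s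
kernels: the walk-kernel hypotheses there (majorant `A·βⁿ`, `A = α`; nearest-neighbour + end-point structure) are
DISCHARGED from [6]'s letters (`walkTerm_entry_hyps`: locality, `‖a_i‖ ≤ α`, `‖b_i‖ ≤ β`, block supports); the label /
cube geometry (`d`, `touch`, `K`, `s`, `μ`, `b₀`, `s₀`; `s/8 ≤ (ρ − b₀)/μ`; `Dβ ≤ e^{−δ}`; `rek ≤ M·s` with `rek` the
print's `r(e_k)L^{k−j}`; largeness `s₀α/(1 − Dβ) ≤ exp(δs/(32K²))`) stays as in that theorem:
`|G_X(x₁,x₂)| ≤ exp(−(δ/(32K²M))·rek·|X|)`, `|X|` the number of cubes of `X`. [cite: BalabanImbrieJaffe1988, (5.7.8) p.291] -/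
theorem abs_gX_le (adj : ι → ι → Prop) [DecidableRel adj] (blk : σ → ι → Prop) {a b : ι → Matrix σ σ ℝ}
    {α β : ℝ} (hab : ∀ i l, ¬ adj i l → a i * b l = 0) (hbb : ∀ i l, ¬ adj i l → b i * b l = 0)
    (hα0 : 0 ≤ α) (hα : ∀ i, ‖a i‖ ≤ α) (hβ0 : 0 ≤ β) (hβ : ∀ i, ‖b i‖ ≤ β)
    (haR : ∀ j x, ¬ blk x j → ∀ z, a j x z = 0) (haC : ∀ j x, ¬ blk x j → ∀ z, a j z x = 0)
    (hbC : ∀ j x, ¬ blk x j → ∀ z, b j z x = 0)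
    (ldist : ι → σ → ℝ) (ρ : ℝ) (cubeOf : ι → κ) (cadj : κ → κ → Prop) [DecidableRel cadj]
    (d : ι → ι → ℝ) (hd0 : ∀ i, d i i = 0) (hdsymm : ∀ i l, d i l = d l i)
    (htri : ∀ i j l, d i l ≤ d i j + d j l) (hadj : ∀ i l, adj i l → d i l ≤ 1)
    (touch : κ → κ → Prop) [DecidableRel touch] (hrefl : ∀ c, touch c c)
    (htsymm : ∀ c c', touch c c' → touch c' c) {K : ℕ}
    (hK : ∀ (c : κ) (Y : Finset κ), (Y.filter fun c' => touch c c').card ≤ K)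
    (hKc : ∀ c : κ, (Finset.univ.filter fun c' => c = c' ∨ cadj c c').card ≤ K)
    {s : ℕ} (hfar : ∀ i l, ¬ touch (cubeOf i) (cubeOf l) → (s : ℝ) ≤ d i l)
    {μ b₀ : ℝ} (hμ : 0 < μ) (hld : ∀ (i l : ι) (x : σ), ldist l x ≤ ldist i x + μ * d i l)
    (hb : ∀ (x : σ) (i : ι), blk x i → ldist i x ≤ b₀) (hρ : (s : ℝ) / 8 ≤ (ρ - b₀) / μ)
    {δ : ℝ} {D s₀ : ℕ} (hD : ∀ j, (Finset.univ.filter fun i => adj j i).card ≤ D) (hδ : 0 < δ)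
    (hθ : (D : ℝ) * β ≤ Real.exp (-δ))
    (hS₀ : ∀ x, ∃ S₀ : Finset ι, S₀.card ≤ s₀ ∧ ∀ i, blk x i → i ∈ S₀)
    {M rek : ℝ} (hM : 0 < M) (hs : rek ≤ M * s)
    (hlarge : s₀ * α / (1 - D * β) ≤ Real.exp (δ * s / (32 * K * K))) (X : Finset κ) (x₁ x₂ : σ) :
    |cX ldist ρ cubeOf cadj (fun ω x₁ x₂ => walkTerm a b ω x₁ x₂) X x₁ x₂| ≤
      Real.exp (-(δ / (32 * K * K * M)) * rek * (X.card : ℕ)) := by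
  obtain ⟨hmaj, hnz⟩ := walkTerm_entry_hyps blk adj hab hbb hα hβ haR haC hbC
  exact abs_cX_le_printed adj ldist ρ cubeOf cadj _ blk d hd0 hdsymm htri hadj touch hrefl htsymm hK hKc hfar hμ hld
    hb hρ hα0 hβ0 hD hδ hθ hmaj hnz hS₀ hM hs hlarge X x₁ x₂

/-! ## §7 *"The dependence on u is in X only; for G_{j,loc} … near x₁, x₂. … G_{j,loc} is independent of Ω."* -/

section Congruence

omit [Fintype ι] [Fintype σ] [DecidableEq σ] [Fintype κ] [DecidableEq κ] in
/-- **[6]'s TERM `G(ω)` DEPENDS ON THE LETTERS AT THE VISITED LABELS ONLY**: two letter families which coincide at every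
label visited by `ω` have the same walk term `a_{ω₀}b_{ω₁}⋯b_{ω_n}` (so `G(ω)` depends on `u`, and on `Ω`, only through
the cube operators `G_k(□_{ω_i} ∩ Ω, Ã_{ω_i})`, `h_{ω_i}`, `K_{ω_i}` along the walk). [cite: BalabanImbrieJaffe1988, (5.7.8) p.291] -/
theorem walkTerm_congr {R : Type*} [NormedRing R] {a b a' b' : ι → R} (ω : Walk ι)
    (ha : ∀ j ∈ ω.pts, a j = a' j) (hb : ∀ j ∈ ω.pts, b j = b' j) : walkTerm a b ω = walkTerm a' b' ω := by
  unfold walkTerm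
  rw [ha _ ω.start_mem_pts,
    BIJ88Locality246Lattice.bprod_congr_of_eq ω.len ω.steps fun i => hb _ (ω.steps_mem_pts i)]

omit [Fintype ι] [Fintype σ] [DecidableEq σ] in
/-- **AGREEMENT OF THE `X`-PARTS** (the mechanism of *"The dependence on u is in X only"*): two walk-kernel families
which coincide on every walk all of whose labels satisfy `P` have the same `X`-part whenever every label with cube in `X`
satisfies `P` — a walk of the class `X` visits only labels whose cube lies in `X(ω) = X`.
[cite: BalabanImbrieJaffe1988, (5.7.8) p.291] -/
theorem cX_congr (ldist : ι → σ → ℝ) (ρ : ℝ) (cubeOf : ι → κ) (cadj : κ → κ → Prop)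
    {Cw Cw' : Walk ι → σ → σ → ℝ} (P : ι → Prop) (hagree : ∀ ω : Walk ι, (∀ j ∈ ω.pts, P j) → Cw ω = Cw' ω)
    {X : Finset κ} (hP : ∀ j, cubeOf j ∈ X → P j) (x₁ x₂ : σ) :
    cX ldist ρ cubeOf cadj Cw X x₁ x₂ = cX ldist ρ cubeOf cadj Cw' X x₁ x₂ := by
  unfold cX
  refine tsum_congr fun ω => ?_
  by_cases hω : ¬ Near ldist ρ ω x₁ x₂ ∧ region cubeOf cadj ω = X
  · have hvis : ∀ j ∈ ω.pts, P j := fun j hj => hP j (by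
      rw [← hω.2]
      exact subset_closure cadj _ (Finset.mem_image_of_mem cubeOf hj))
    rw [Set.indicator_of_mem (show ω ∈ {ω : Walk ι | ¬ Near ldist ρ ω x₁ x₂ ∧ region cubeOf cadj ω = X} from hω),
      Set.indicator_of_mem (show ω ∈ {ω : Walk ι | ¬ Near ldist ρ ω x₁ x₂ ∧ region cubeOf cadj ω = X} from hω),
      hagree ω hvis]
  · rw [Set.indicator_of_notMem (show ω ∉ {ω : Walk ι | ¬ Near ldist ρ ω x₁ x₂ ∧ region cubeOf cadj ω = X} from hω),
      Set.indicator_of_notMem (show ω ∉ {ω : Walk ι | ¬ Near ldist ρ ω x₁ x₂ ∧ region cubeOf cadj ω = X} from hω)]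

omit [Fintype ι] in
/-- **"The dependence on u is in X only"** p. 291 — PROVED as a congruence for [6]'s kernels: two letter families
`(a,b)`, `(a′,b′)` — [6]'s letters for two background fields `u, u′` (or for two regions `Ω, Ω′` realized on one site
set) — which COINCIDE AT EVERY LABEL WHOSE CUBE LIES IN `X` give the same `G_j(Ω,X,·)(x₁,x₂)` for all sites; since
`a_j, b_j` see `u` only inside `□_j`, letters of `u, u′` agreeing on `X` coincide there.
[cite: BalabanImbrieJaffe1988, (5.7.8) p.291] -/
theorem gX_congr {a b a' b' : ι → Matrix σ σ ℝ} (ldist : ι → σ → ℝ) (ρ : ℝ) (cubeOf : ι → κ)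
    (cadj : κ → κ → Prop) {X : Finset κ} (ha : ∀ j, cubeOf j ∈ X → a j = a' j)
    (hb : ∀ j, cubeOf j ∈ X → b j = b' j) (x₁ x₂ : σ) :
    cX ldist ρ cubeOf cadj (fun ω x₁ x₂ => walkTerm a b ω x₁ x₂) X x₁ x₂ =
      cX ldist ρ cubeOf cadj (fun ω x₁ x₂ => walkTerm a' b' ω x₁ x₂) X x₁ x₂ :=
  cX_congr ldist ρ cubeOf cadj (fun j => cubeOf j ∈ X)
    (fun ω hω => by
      funext y₁ y₂
      exact congrFun (congrFun (walkTerm_congr (R := Matrix σ σ ℝ) ω (fun j hj => ha j (hω j hj))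
        fun j hj => hb j (hω j hj)) y₁) y₂)
    (fun _ h => h) x₁ x₂

omit [Fintype ι] [Fintype κ] [DecidableEq κ] in
/-- **"for G_{j,loc} it is only in an L^{k−j}r(e_k)-neighborhood of x₁, x₂. Also, when x₁ and x₂ are farther than
L^{k−j}r(e_k) from Ω^c, G_{j,loc} is independent of Ω."** p. 291 — PROVED as ONE congruence for [6]'s kernels: two
letter families which COINCIDE AT EVERY LABEL WITHIN `ρ` OF `x₁` (and of `x₂`) give the same `G_loc(x₁,x₂)`
(`BIJ88RandomWalk242.cLoc_congr`).  Dictionary: letters of two backgrounds `u, u′` equal on the `ρ + O(M)`-neighbourhood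
of `x₁, x₂` coincide at those labels (first sentence); letters of two regions `Ω ⊇ Ω′` coincide at the labels `j` with
`□_j ⊂ Ω′`, which holds for all labels within `ρ` of `x₁` once `dist(x₁, Ω′^c) > ρ + O(M)` (second sentence).
[cite: BalabanImbrieJaffe1988, (5.7.8) p.291] -/
theorem gLoc_congr {a b a' b' : ι → Matrix σ σ ℝ} (ldist : ι → σ → ℝ) (ρ : ℝ) {x₁ x₂ : σ}
    (ha : ∀ j, ldist j x₁ ≤ ρ → ldist j x₂ ≤ ρ → a j = a' j)
    (hb : ∀ j, ldist j x₁ ≤ ρ → ldist j x₂ ≤ ρ → b j = b' j) :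
    cLoc ldist ρ (fun ω x₁ x₂ => walkTerm a b ω x₁ x₂) x₁ x₂ =
      cLoc ldist ρ (fun ω x₁ x₂ => walkTerm a' b' ω x₁ x₂) x₁ x₂ :=
  cLoc_congr ldist ρ (fun j => ldist j x₁ ≤ ρ ∧ ldist j x₂ ≤ ρ)
    (fun ω hω => by
      funext y₁ y₂
      exact congrFun (congrFun (walkTerm_congr (R := Matrix σ σ ℝ) ω (fun j hj => ha j (hω j hj).1 (hω j hj).2)
        fun j hj => hb j (hω j hj).1 (hω j hj).2) y₁) y₂)
    (fun _ h1 h2 => ⟨h1, h2⟩)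

end Congruence

/-! ## §8 (v1.1) p. 293: *"We write G_{j,loc}(u_{k+1}) = G_j(Λ̄₂^{(m)},u_{k+1}) + (G_{j,loc}(u_{k+1}) − G_{j,loc}(Λ̄₂^{(m)},u_{k+1}))
+ Σ_X G_j(Λ̄₂^{(m)},X,u_{k+1})"* — DERIVED from (5.7.8), with the sign of the last sum CORRECTED

p. 293 [PDF 37], verbatim: *"We need to replace the propagators G_{j,loc}(u_{k+1}), G_j(□,u_{k+1}) by G_j(Λ̄₂^{(m)},u_{k+1}). They
appear in the expansion of Δ_{j,loc}(u_{k+1}) and indirectly in C^{(j)}(u_{k+1}). We write G_{j,loc}(u_{k+1}) =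
G_j(Λ̄₂^{(m)},u_{k+1}) + (G_{j,loc}(u_{k+1}) − G_{j,loc}(Λ̄₂^{(m)},u_{k+1})) + Σ_X G_j(Λ̄₂^{(m)},X,u_{k+1}), and similarly for
G_{j,loc}(□,u_{k+1})."*  By (5.7.8) for `Ω = Λ̄₂^{(m)}`, `G_j(Λ̄₂) = G_{j,loc}(Λ̄₂) + Σ_X G_j(Λ̄₂,X)`, hence for ANY kernel `G_{j,loc}(u)`
(the object (2.28)) `G_{j,loc}(u) = G_j(Λ̄₂) + (G_{j,loc}(u) − G_{j,loc}(Λ̄₂)) − Σ_X G_j(Λ̄₂,X)`: the printed `+ Σ_X` is a SIGN SLIP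
(transcript note HOME/GAPS.md G-C2-p13-g7-1; harmless downstream, where only `|G_j(Λ̄₂,X)|` is used).  The identity is
pure bookkeeping on top of (5.7.8) and is stated for arbitrary `Eq245` data. -/

section Display293

variable {ξ : Type*} [Fintype ξ]

omit [Fintype ι] [DecidableEq ι] [Fintype σ] [DecidableEq σ] [Fintype κ] [DecidableEq κ] in
/-- **THE p. 293 REWRITING OF `G_{j,loc}(u)`, SIGN CORRECTED**: whenever `C = C_loc + Σ_X C_X` ((5.7.8) for `Ω = Λ̄₂^{(m)}`:
`C = G_j(Λ̄₂,·)`, `C_loc = G_{j,loc}(Λ̄₂,·)`, `C_X = G_j(Λ̄₂,X,·)`), every kernel `G` (the print's `G_{j,loc}(u_{k+1})`)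
satisfies `G = C + (G − C_loc) − Σ_X C_X` pointwise. [cite: BalabanImbrieJaffe1988, (5.7.11) p.293] -/
theorem display293 {C Cloc : σ → σ → ℝ} {CX : ξ → σ → σ → ℝ} (h : BIJ88Sect2Statements.Eq245 C Cloc CX)
    (G : σ → σ → ℝ) (x₁ x₂ : σ) :
    G x₁ x₂ = C x₁ x₂ + (G x₁ x₂ - Cloc x₁ x₂) - ∑ X, CX X x₁ x₂ := by
  rw [h x₁ x₂]; ring

omit [Fintype ι] [DecidableEq ι] [Fintype σ] [DecidableEq σ] [Fintype κ] [DecidableEq κ] in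
/-- **THE DISPLAY AS PRINTED (`+ Σ_X`) HOLDS IFF THE `X`-PARTS SUM TO ZERO** at the point considered — given (5.7.8); so
the printed sign is a slip wherever `Σ_X G_j(Λ̄₂,X)(x₁,x₂) ≠ 0`. [cite: BalabanImbrieJaffe1988, (5.7.11) p.293] -/
theorem display293_asPrinted_iff {C Cloc : σ → σ → ℝ} {CX : ξ → σ → σ → ℝ} (h : BIJ88Sect2Statements.Eq245 C Cloc CX)
    (G : σ → σ → ℝ) (x₁ x₂ : σ) :
    (G x₁ x₂ = C x₁ x₂ + (G x₁ x₂ - Cloc x₁ x₂) + ∑ X, CX X x₁ x₂) ↔ ∑ X, CX X x₁ x₂ = 0 := by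
  rw [h x₁ x₂]
  constructor
  · intro h'; linarith
  · intro h'; linarith

/-- the p. 293 rewriting for [6]'s kernels: under the hypotheses of `hasSum_G` (for the region `Ω = Λ̄₂^{(m)}`), every
kernel `G_{j,loc}` satisfies `G_{j,loc} = G + (G_{j,loc} − G_loc) − Σ_X G_X` with the `G_loc`, `G_X` of `eq578`.
[cite: BalabanImbrieJaffe1988, (5.7.11) p.293] -/
theorem display293_G (adj : ι → ι → Prop) [DecidableRel adj] {a b : ι → Matrix σ σ ℝ} {G : Matrix σ σ ℝ} {α β : ℝ}
    {D : ℕ} (hab : ∀ i l, ¬ adj i l → a i * b l = 0) (hbb : ∀ i l, ¬ adj i l → b i * b l = 0)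
    (hα : ∀ i, ‖a i‖ ≤ α) (hβ : ∀ i, ‖b i‖ ≤ β) (hD : ∀ j, (Finset.univ.filter fun i => adj j i).card ≤ D)
    (hDβ : (D : ℝ) * β < 1) (hR : ‖∑ i, b i‖ < 1) (hG : G * (1 - ∑ i, b i) = ∑ i, a i)
    (ldist : ι → σ → ℝ) (ρ : ℝ) (cubeOf : ι → κ) (cadj : κ → κ → Prop) (Gjloc : σ → σ → ℝ) (x₁ x₂ : σ) :
    Gjloc x₁ x₂ = G x₁ x₂ + (Gjloc x₁ x₂ - cLoc ldist ρ (fun ω x₁ x₂ => walkTerm a b ω x₁ x₂) x₁ x₂)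
      - ∑ X, cX ldist ρ cubeOf cadj (fun ω x₁ x₂ => walkTerm a b ω x₁ x₂) X x₁ x₂ :=
  display293 (eq578 adj hab hbb hα hβ hD hDβ hR hG ldist ρ cubeOf cadj) Gjloc x₁ x₂

end Display293

/-! ## §9 (v1.2) p. 294: *"As always, X is a connected union of L^{k−j}r(e_k)-cubes"* — for [6]'s kernels

p. 294 [PDF 38], verbatim: *"As always, X is a connected union of L^{k−j}r(e_k)-cubes, and W^{(j)(iv)}(X) has dependence
only on fields in X, X̄, or B_{k−j}(X)."*; (5.7.8) p. 291: *"walks that remain inside X, a union of L^{k−j}r(e_k)-cubes"*.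
For the kernels of §1–§3 the cube region of a CONTRIBUTING walk is connected: the nonzero terms `G(ω)` live on
nearest-neighbour walks (`walkTerm_entry_hyps`, the locality `a_i b_l = 0 = b_i b_l` unless `adj i l`), and adjacent
labels have equal or adjacent cubes (`hstep`: the blocks `□_j` of side `O(M)`, `M ≤` the cube side) — the (2.44)
mechanism `BIJ88RandomWalk242.cX_ne_zero_connected`.  (The field-dependence clause for `W^{(j)(iv)}` concerns the
perturbative remainders and is not an object of this file.) -/

section Connected

omit [Fintype ι] in
/-- **"As always, X is a connected union of L^{k−j}r(e_k)-cubes"** p. 294 — PROVED for [6]'s kernels: if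
`G_j(Ω,X,u)(x₁,x₂) ≠ 0` then the cube graph (adjacency `cadj`) induced on `X` is connected, for every `ldist`, `ρ`.
[cite: BalabanImbrieJaffe1988, (5.7.10) p.294] -/
theorem gX_ne_zero_connected (adj : ι → ι → Prop) (blk : σ → ι → Prop) {a b : ι → Matrix σ σ ℝ} {α β : ℝ}
    (hab : ∀ i l, ¬ adj i l → a i * b l = 0) (hbb : ∀ i l, ¬ adj i l → b i * b l = 0)
    (hα : ∀ i, ‖a i‖ ≤ α) (hβ : ∀ i, ‖b i‖ ≤ β)
    (haR : ∀ j x, ¬ blk x j → ∀ z, a j x z = 0) (haC : ∀ j x, ¬ blk x j → ∀ z, a j z x = 0)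
    (hbC : ∀ j x, ¬ blk x j → ∀ z, b j z x = 0)
    (ldist : ι → σ → ℝ) (ρ : ℝ) (cubeOf : ι → κ) (cadj : κ → κ → Prop)
    (hstep : ∀ j j', adj j j' → cubeOf j = cubeOf j' ∨ cadj (cubeOf j) (cubeOf j') ∨ cadj (cubeOf j') (cubeOf j))
    {X : Finset κ} {x₁ x₂ : σ} (h : cX ldist ρ cubeOf cadj (fun ω x₁ x₂ => walkTerm a b ω x₁ x₂) X x₁ x₂ ≠ 0) :
    ((SimpleGraph.fromRel cadj).induce (↑X : Set κ)).Connected :=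
  cX_ne_zero_connected ldist ρ cubeOf cadj adj hstep
    (fun ω z₁ z₂ hz => ((walkTerm_entry_hyps blk adj hab hbb hα hβ haR haC hbC).2 ω z₁ z₂ hz).1) h

open Classical in
omit [Fintype ι] in
/-- hence in (5.7.8) the typed sum over ALL cube sets `X` IS the printed sum over the connected unions of cubes.
[cite: BalabanImbrieJaffe1988, (5.7.8) p.291] -/
theorem sum_gX_eq_sum_connected (adj : ι → ι → Prop) (blk : σ → ι → Prop) {a b : ι → Matrix σ σ ℝ} {α β : ℝ}
    (hab : ∀ i l, ¬ adj i l → a i * b l = 0) (hbb : ∀ i l, ¬ adj i l → b i * b l = 0)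
    (hα : ∀ i, ‖a i‖ ≤ α) (hβ : ∀ i, ‖b i‖ ≤ β)
    (haR : ∀ j x, ¬ blk x j → ∀ z, a j x z = 0) (haC : ∀ j x, ¬ blk x j → ∀ z, a j z x = 0)
    (hbC : ∀ j x, ¬ blk x j → ∀ z, b j z x = 0)
    (ldist : ι → σ → ℝ) (ρ : ℝ) (cubeOf : ι → κ) (cadj : κ → κ → Prop)
    (hstep : ∀ j j', adj j j' → cubeOf j = cubeOf j' ∨ cadj (cubeOf j) (cubeOf j') ∨ cadj (cubeOf j') (cubeOf j))
    (x₁ x₂ : σ) :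
    ∑ X, cX ldist ρ cubeOf cadj (fun ω x₁ x₂ => walkTerm a b ω x₁ x₂) X x₁ x₂ =
      ∑ X ∈ Finset.univ.filter (fun X : Finset κ => ((SimpleGraph.fromRel cadj).induce (↑X : Set κ)).Connected),
        cX ldist ρ cubeOf cadj (fun ω x₁ x₂ => walkTerm a b ω x₁ x₂) X x₁ x₂ :=
  (Finset.sum_filter_of_ne fun _ _ hX =>
    gX_ne_zero_connected adj blk hab hbb hα hβ haR haC hbC ldist ρ cubeOf cadj hstep hX).symm

end Connected

end Literature.MathematicalPhysics.QuantumFieldTheory.BalabanImbrieJaffe1984to88.BIJ88RandomWalk578
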